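import Summits.Ventures.Crystal3D.Theorems.StickyWulffConstantPolycrystalWulffBoundAggCuts

/-!
# `PolycrystalWulffBound`, line `PolyDensity`: finite-sum identities for the aggregated step (part 3b)

Route `StickyWulffConstant` of the venture `Summits/Ventures/Crystal3D`, crux `PolycrystalWulffBound`
(item `stmt-Ventures-19482`), second prover lane (poly-p2, gen 7).  The aggregated middle-band LP
(`def AggCert27_8`) is written in NAMED variables attached to three distinguished classes `a, b, c` of a
finite class type `β` and the remainder `T = univ \ {a,b,c}` (`F_R = Σ_{r∈T} F r`, `A_1R = Σ_{r∈T} Acl a r`,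
`A_RR = (Σ_{i∈T} Σ_{j∈T∖{i}} Acl i j)/2`, …), while the generic class rows (`aggStaticRows`,
`rec_row_classes`, `del_row_classes`) speak of sums over a set of classes `P` and over its complement.
This file is the dictionary: for each of the fifteen sets `P ⊆ {a,b,c,T}` that occur, the value of
`Σ_{i∈P} φ i` and of the cut `Σ_{i∈P} Σ_{j∉P} Acl i j` (symmetric `Acl`) in the named variables, the
singles-sum identity over `T`, the restricted form of the off-diagonal pair sum, and the symmetry of cuts.
Pure finite-sum bookkeeping over a `Fintype`; no geometry.
WHAT THIS IS NOT: any inequality; F-C1 not moved.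
-/

namespace Summit.Ventures.Crystal3D.Theorems

open Finset

variable {β : Type} [Fintype β] [DecidableEq β]

/-- `Σ_{univ \ {b}} φ = φ a + φ c + Σ_T φ`. -/
theorem sum_sdiff_single_split_b {a b c : β} (hab : a ≠ b) (hbc : b ≠ c) (hac : a ≠ c) (φ : β → ℝ) :
    ∑ l ∈ univ \ {b}, φ l = φ a + φ c + ∑ l ∈ univ \ {a, b, c}, φ l := by
  have h1 := sum_univ_split_three hab hbc hac φ
  have h2 : ∑ l, φ l = φ b + ∑ l ∈ univ \ {b}, φ l := by
    rw [← sum_sdiff (subset_univ ({b} : Finset β)), sum_singleton]; ring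
  linarith

/-- `Σ_{univ \ {c}} φ = φ a + φ b + Σ_T φ`. -/
theorem sum_sdiff_single_split_c {a b c : β} (hab : a ≠ b) (hbc : b ≠ c) (hac : a ≠ c) (φ : β → ℝ) :
    ∑ l ∈ univ \ {c}, φ l = φ a + φ b + ∑ l ∈ univ \ {a, b, c}, φ l := by
  have h1 := sum_univ_split_three hab hbc hac φ
  have h2 : ∑ l, φ l = φ c + ∑ l ∈ univ \ {c}, φ l := by
    rw [← sum_sdiff (subset_univ ({c} : Finset β)), sum_singleton]; ring
  linarith

/-- `Σ_{univ \ {a,c}} φ = φ b + Σ_T φ`. -/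
theorem sum_sdiff_pair_split_ac {a b c : β} (hab : a ≠ b) (hbc : b ≠ c) (hac : a ≠ c) (φ : β → ℝ) :
    ∑ l ∈ univ \ {a, c}, φ l = φ b + ∑ l ∈ univ \ {a, b, c}, φ l := by
  have h1 := sum_univ_split_three hab hbc hac φ
  have h2 : ∑ l, φ l = φ a + φ c + ∑ l ∈ univ \ {a, c}, φ l := by
    rw [← sum_sdiff (subset_univ ({a, c} : Finset β)), sum_pair hac]
    ring
  linarith

/-- `Σ_{univ \ {b,c}} φ = φ a + Σ_T φ`. -/
theorem sum_sdiff_pair_split_bc {a b c : β} (hab : a ≠ b) (hbc : b ≠ c) (hac : a ≠ c) (φ : β → ℝ) :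
    ∑ l ∈ univ \ {b, c}, φ l = φ a + ∑ l ∈ univ \ {a, b, c}, φ l := by
  have h1 := sum_univ_split_three hab hbc hac φ
  have h2 : ∑ l, φ l = φ b + φ c + ∑ l ∈ univ \ {b, c}, φ l := by
    rw [← sum_sdiff (subset_univ ({b, c} : Finset β)), sum_pair hbc]
    ring
  linarith

omit [Fintype β] in
/-- `Σ_{{a,b,c}} φ = φ a + φ b + φ c`. -/
theorem sum_three {a b c : β} (hab : a ≠ b) (hbc : b ≠ c) (hac : a ≠ c) (φ : β → ℝ) :
    ∑ l ∈ ({a, b, c} : Finset β), φ l = φ a + φ b + φ c := by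
  rw [sum_insert (by simp [hab, hac]), sum_insert (by simp [hbc]), sum_singleton]; ring

/-- `a ∉ T`. -/
theorem not_mem_remainder_a (a b c : β) : a ∉ univ \ ({a, b, c} : Finset β) := by simp
/-- `b ∉ T`. -/
theorem not_mem_remainder_b (a b c : β) : b ∉ univ \ ({a, b, c} : Finset β) := by simp
/-- `c ∉ T`. -/
theorem not_mem_remainder_c (a b c : β) : c ∉ univ \ ({a, b, c} : Finset β) := by simp

/-- `Σ_{insert a T} φ = φ a + Σ_T φ`. -/
theorem sum_insert_remainder_a (a b c : β) (φ : β → ℝ) :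
    ∑ l ∈ insert a (univ \ ({a, b, c} : Finset β)), φ l = φ a + ∑ l ∈ univ \ {a, b, c}, φ l :=
  sum_insert (not_mem_remainder_a a b c)
/-- `Σ_{insert b T} φ = φ b + Σ_T φ`. -/
theorem sum_insert_remainder_b (a b c : β) (φ : β → ℝ) :
    ∑ l ∈ insert b (univ \ ({a, b, c} : Finset β)), φ l = φ b + ∑ l ∈ univ \ {a, b, c}, φ l :=
  sum_insert (not_mem_remainder_b a b c)
/-- `Σ_{insert c T} φ = φ c + Σ_T φ`. -/
theorem sum_insert_remainder_c (a b c : β) (φ : β → ℝ) :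
    ∑ l ∈ insert c (univ \ ({a, b, c} : Finset β)), φ l = φ c + ∑ l ∈ univ \ {a, b, c}, φ l :=
  sum_insert (not_mem_remainder_c a b c)

/-- `Σ_{insert a (insert b T)} φ = φ a + φ b + Σ_T φ`. -/
theorem sum_insert_insert_remainder_ab {a b : β} (c : β) (hab : a ≠ b) (φ : β → ℝ) :
    ∑ l ∈ insert a (insert b (univ \ ({a, b, c} : Finset β))), φ l = φ a + φ b + ∑ l ∈ univ \ {a, b, c}, φ l := by
  rw [sum_insert (by simp [hab]), sum_insert (not_mem_remainder_b a b c)]; ring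
/-- `Σ_{insert a (insert c T)} φ = φ a + φ c + Σ_T φ`. -/
theorem sum_insert_insert_remainder_ac {a c : β} (b : β) (hac : a ≠ c) (φ : β → ℝ) :
    ∑ l ∈ insert a (insert c (univ \ ({a, b, c} : Finset β))), φ l = φ a + φ c + ∑ l ∈ univ \ {a, b, c}, φ l := by
  rw [sum_insert (by simp [hac]), sum_insert (not_mem_remainder_c a b c)]; ring
/-- `Σ_{insert b (insert c T)} φ = φ b + φ c + Σ_T φ`. -/
theorem sum_insert_insert_remainder_bc {b c : β} (a : β) (hbc : b ≠ c) (φ : β → ℝ) :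
    ∑ l ∈ insert b (insert c (univ \ ({a, b, c} : Finset β))), φ l = φ b + φ c + ∑ l ∈ univ \ {a, b, c}, φ l := by
  rw [sum_insert (by simp [hbc]), sum_insert (not_mem_remainder_c a b c)]; ring

/-- `univ \ insert b T = {a,c}`. -/
theorem sdiff_insert_remainder_b {a b c : β} (hab : a ≠ b) (hbc : b ≠ c) :
    univ \ insert b (univ \ ({a, b, c} : Finset β)) = {a, c} := by
  ext x
  by_cases hxa : x = a <;> by_cases hxb : x = b <;> by_cases hxc : x = c <;> simp_all
/-- `univ \ insert c T = {a,b}`. -/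
theorem sdiff_insert_remainder_c {a b c : β} (hbc : b ≠ c) (hac : a ≠ c) :
    univ \ insert c (univ \ ({a, b, c} : Finset β)) = {a, b} := by
  ext x
  by_cases hxa : x = a <;> by_cases hxb : x = b <;> by_cases hxc : x = c <;> simp_all
/-- `univ \ insert a (insert c T) = {b}`. -/
theorem sdiff_insert_insert_remainder_ac {a b c : β} (hab : a ≠ b) (hbc : b ≠ c) :
    univ \ insert a (insert c (univ \ ({a, b, c} : Finset β))) = {b} := by
  ext x
  by_cases hxa : x = a <;> by_cases hxb : x = b <;> by_cases hxc : x = c <;> simp_all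
/-- `univ \ insert b (insert c T) = {a}`. -/
theorem sdiff_insert_insert_remainder_bc {a b c : β} (hab : a ≠ b) (hac : a ≠ c) :
    univ \ insert b (insert c (univ \ ({a, b, c} : Finset β))) = {a} := by
  ext x
  by_cases hxa : x = a <;> by_cases hxb : x = b <;> by_cases hxc : x = c <;> simp_all

omit [Fintype β] [DecidableEq β] in
/-- A column sum turned into a row sum (symmetry of `Acl`). -/
theorem sum_remainder_symm (Acl : β → β → ℝ) (hs : ∀ i j, Acl i j = Acl j i) (S : Finset β) (x : β) :
    ∑ r ∈ S, Acl r x = ∑ r ∈ S, Acl x r :=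
  sum_congr rfl fun r _ => hs r x

/-- Cut of the remainder `T`: `Σ_{i∈T} Σ_{j∉T} Acl i j = A_1R + A_2R + A_3R`. -/
theorem cut_remainder (Acl : β → β → ℝ) (hs : ∀ i j, Acl i j = Acl j i) {a b c : β} (hab : a ≠ b)
    (hbc : b ≠ c) (hac : a ≠ c) :
    ∑ i ∈ univ \ ({a, b, c} : Finset β), ∑ j ∈ univ \ (univ \ ({a, b, c} : Finset β)), Acl i j =
      (∑ r ∈ univ \ {a, b, c}, Acl a r) + (∑ r ∈ univ \ {a, b, c}, Acl b r) + ∑ r ∈ univ \ {a, b, c}, Acl c r := by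
  rw [sdiff_sdiff_three]
  rw [show (∑ i ∈ univ \ ({a, b, c} : Finset β), ∑ j ∈ ({a, b, c} : Finset β), Acl i j) =
      ∑ i ∈ univ \ ({a, b, c} : Finset β), (Acl i a + Acl i b + Acl i c) from
    sum_congr rfl fun i _ => sum_three hab hbc hac (Acl i)]
  rw [sum_add_distrib, sum_add_distrib, sum_remainder_symm Acl hs _ a, sum_remainder_symm Acl hs _ b,
    sum_remainder_symm Acl hs _ c]

/-- Cut of `{a,b,c}`: `= A_1R + A_2R + A_3R`. -/
theorem cut_three (Acl : β → β → ℝ) {a b c : β} (hab : a ≠ b) (hbc : b ≠ c) (hac : a ≠ c) :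
    ∑ i ∈ ({a, b, c} : Finset β), ∑ j ∈ univ \ ({a, b, c} : Finset β), Acl i j =
      (∑ r ∈ univ \ {a, b, c}, Acl a r) + (∑ r ∈ univ \ {a, b, c}, Acl b r) + ∑ r ∈ univ \ {a, b, c}, Acl c r :=
  sum_three hab hbc hac _

/-- Cut of a single class `a`: `= A_12 + A_13 + A_1R`. -/
theorem cut_single_a (Acl : β → β → ℝ) {a b c : β} (hab : a ≠ b) (hbc : b ≠ c) (hac : a ≠ c) :
    ∑ i ∈ ({a} : Finset β), ∑ j ∈ univ \ {a}, Acl i j = Acl a b + Acl a c + ∑ r ∈ univ \ {a, b, c}, Acl a r := by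
  rw [sum_singleton, sum_sdiff_single_split hab hbc hac]
/-- Cut of a single class `b`: `= A_12 + A_23 + A_2R`. -/
theorem cut_single_b (Acl : β → β → ℝ) (hs : ∀ i j, Acl i j = Acl j i) {a b c : β} (hab : a ≠ b) (hbc : b ≠ c)
    (hac : a ≠ c) :
    ∑ i ∈ ({b} : Finset β), ∑ j ∈ univ \ {b}, Acl i j = Acl a b + Acl b c + ∑ r ∈ univ \ {a, b, c}, Acl b r := by
  rw [sum_singleton, sum_sdiff_single_split_b hab hbc hac, hs b a]
/-- Cut of a single class `c`: `= A_13 + A_23 + A_3R`. -/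
theorem cut_single_c (Acl : β → β → ℝ) (hs : ∀ i j, Acl i j = Acl j i) {a b c : β} (hab : a ≠ b) (hbc : b ≠ c)
    (hac : a ≠ c) :
    ∑ i ∈ ({c} : Finset β), ∑ j ∈ univ \ {c}, Acl i j = Acl a c + Acl b c + ∑ r ∈ univ \ {a, b, c}, Acl c r := by
  rw [sum_singleton, sum_sdiff_single_split_c hab hbc hac, hs c a, hs c b]

/-- Cut of the pair `{a,b}`: `= A_13 + A_1R + A_23 + A_2R`. -/
theorem cut_pair_ab (Acl : β → β → ℝ) {a b c : β} (hab : a ≠ b) (hbc : b ≠ c) (hac : a ≠ c) :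
    ∑ i ∈ ({a, b} : Finset β), ∑ j ∈ univ \ {a, b}, Acl i j =
      Acl a c + (∑ r ∈ univ \ {a, b, c}, Acl a r) + Acl b c + ∑ r ∈ univ \ {a, b, c}, Acl b r := by
  rw [sum_pair hab, sum_sdiff_pair_split hab hbc hac, sum_sdiff_pair_split hab hbc hac]; ring
/-- Cut of the pair `{a,c}`: `= A_12 + A_1R + A_23 + A_3R`. -/
theorem cut_pair_ac (Acl : β → β → ℝ) (hs : ∀ i j, Acl i j = Acl j i) {a b c : β} (hab : a ≠ b) (hbc : b ≠ c)
    (hac : a ≠ c) :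
    ∑ i ∈ ({a, c} : Finset β), ∑ j ∈ univ \ {a, c}, Acl i j =
      Acl a b + (∑ r ∈ univ \ {a, b, c}, Acl a r) + Acl b c + ∑ r ∈ univ \ {a, b, c}, Acl c r := by
  rw [sum_pair hac, sum_sdiff_pair_split_ac hab hbc hac, sum_sdiff_pair_split_ac hab hbc hac, hs c b]; ring
/-- Cut of the pair `{b,c}`: `= A_12 + A_2R + A_13 + A_3R`. -/
theorem cut_pair_bc (Acl : β → β → ℝ) (hs : ∀ i j, Acl i j = Acl j i) {a b c : β} (hab : a ≠ b) (hbc : b ≠ c)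
    (hac : a ≠ c) :
    ∑ i ∈ ({b, c} : Finset β), ∑ j ∈ univ \ {b, c}, Acl i j =
      Acl a b + (∑ r ∈ univ \ {a, b, c}, Acl b r) + Acl a c + ∑ r ∈ univ \ {a, b, c}, Acl c r := by
  rw [sum_pair hbc, sum_sdiff_pair_split_bc hab hbc hac, sum_sdiff_pair_split_bc hab hbc hac, hs b a, hs c a]
  ring

/-- Cut of `insert a T`: `= A_12 + A_13 + A_2R + A_3R`. -/
theorem cut_insert_remainder_a (Acl : β → β → ℝ) (hs : ∀ i j, Acl i j = Acl j i) {a b c : β} (hab : a ≠ b)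
    (hbc : b ≠ c) (hac : a ≠ c) :
    ∑ i ∈ insert a (univ \ ({a, b, c} : Finset β)), ∑ j ∈ univ \ insert a (univ \ ({a, b, c} : Finset β)), Acl i j =
      Acl a b + Acl a c + (∑ r ∈ univ \ {a, b, c}, Acl b r) + ∑ r ∈ univ \ {a, b, c}, Acl c r := by
  rw [sdiff_insert_remainder hab hac, sum_insert_remainder_a]
  simp only [sum_pair hbc]
  rw [sum_add_distrib, sum_remainder_symm Acl hs _ b, sum_remainder_symm Acl hs _ c]; ring
/-- Cut of `insert b T`: `= A_12 + A_23 + A_1R + A_3R`. -/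
theorem cut_insert_remainder_b (Acl : β → β → ℝ) (hs : ∀ i j, Acl i j = Acl j i) {a b c : β} (hab : a ≠ b)
    (hbc : b ≠ c) (hac : a ≠ c) :
    ∑ i ∈ insert b (univ \ ({a, b, c} : Finset β)), ∑ j ∈ univ \ insert b (univ \ ({a, b, c} : Finset β)), Acl i j =
      Acl a b + Acl b c + (∑ r ∈ univ \ {a, b, c}, Acl a r) + ∑ r ∈ univ \ {a, b, c}, Acl c r := by
  rw [sdiff_insert_remainder_b hab hbc, sum_insert_remainder_b]
  simp only [sum_pair hac]
  rw [sum_add_distrib, sum_remainder_symm Acl hs _ a, sum_remainder_symm Acl hs _ c, hs b a]; ring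
/-- Cut of `insert c T`: `= A_13 + A_23 + A_1R + A_2R`. -/
theorem cut_insert_remainder_c (Acl : β → β → ℝ) (hs : ∀ i j, Acl i j = Acl j i) {a b c : β} (hab : a ≠ b)
    (hbc : b ≠ c) (hac : a ≠ c) :
    ∑ i ∈ insert c (univ \ ({a, b, c} : Finset β)), ∑ j ∈ univ \ insert c (univ \ ({a, b, c} : Finset β)), Acl i j =
      Acl a c + Acl b c + (∑ r ∈ univ \ {a, b, c}, Acl a r) + ∑ r ∈ univ \ {a, b, c}, Acl b r := by
  rw [sdiff_insert_remainder_c hbc hac, sum_insert_remainder_c]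
  simp only [sum_pair hab]
  rw [sum_add_distrib, sum_remainder_symm Acl hs _ a, sum_remainder_symm Acl hs _ b, hs c a, hs c b]; ring

/-- Cut of `insert a (insert b T)`: `= A_13 + A_23 + A_3R`. -/
theorem cut_insert_insert_remainder_ab (Acl : β → β → ℝ) (hs : ∀ i j, Acl i j = Acl j i) {a b c : β}
    (hab : a ≠ b) (hbc : b ≠ c) (hac : a ≠ c) :
    ∑ i ∈ insert a (insert b (univ \ ({a, b, c} : Finset β))),
        ∑ j ∈ univ \ insert a (insert b (univ \ ({a, b, c} : Finset β))), Acl i j =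
      Acl a c + Acl b c + ∑ r ∈ univ \ {a, b, c}, Acl c r := by
  rw [sdiff_insert_insert_remainder hac hbc, sum_insert_insert_remainder_ab c hab]
  simp only [sum_singleton]
  rw [sum_remainder_symm Acl hs _ c]
/-- Cut of `insert a (insert c T)`: `= A_12 + A_23 + A_2R`. -/
theorem cut_insert_insert_remainder_ac (Acl : β → β → ℝ) (hs : ∀ i j, Acl i j = Acl j i) {a b c : β}
    (hab : a ≠ b) (hbc : b ≠ c) (hac : a ≠ c) :
    ∑ i ∈ insert a (insert c (univ \ ({a, b, c} : Finset β))),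
        ∑ j ∈ univ \ insert a (insert c (univ \ ({a, b, c} : Finset β))), Acl i j =
      Acl a b + Acl b c + ∑ r ∈ univ \ {a, b, c}, Acl b r := by
  rw [sdiff_insert_insert_remainder_ac hab hbc, sum_insert_insert_remainder_ac b hac]
  simp only [sum_singleton]
  rw [sum_remainder_symm Acl hs _ b, hs c b]
/-- Cut of `insert b (insert c T)`: `= A_12 + A_13 + A_1R`. -/
theorem cut_insert_insert_remainder_bc (Acl : β → β → ℝ) (hs : ∀ i j, Acl i j = Acl j i) {a b c : β}
    (hab : a ≠ b) (hbc : b ≠ c) (hac : a ≠ c) :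
    ∑ i ∈ insert b (insert c (univ \ ({a, b, c} : Finset β))),
        ∑ j ∈ univ \ insert b (insert c (univ \ ({a, b, c} : Finset β))), Acl i j =
      Acl a b + Acl a c + ∑ r ∈ univ \ {a, b, c}, Acl a r := by
  rw [sdiff_insert_insert_remainder_bc hab hac, sum_insert_insert_remainder_bc a hbc]
  simp only [sum_singleton]
  rw [sum_remainder_symm Acl hs _ a, hs b a, hs c a]

/-- Cut of everything is empty. -/
theorem cut_univ (Acl : β → β → ℝ) : ∑ i ∈ (univ : Finset β), ∑ j ∈ univ \ univ, Acl i j = 0 := by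
  simp

/-- Singles-sum over the remainder: `Σ_{i∈T} Σ_{j≠i} Acl i j = A_1R + A_2R + A_3R + Σ_{i∈T} Σ_{j∈T∖{i}} Acl i j`. -/
theorem singles_sum_remainder (Acl : β → β → ℝ) (hs : ∀ i j, Acl i j = Acl j i) {a b c : β} (hab : a ≠ b)
    (hbc : b ≠ c) (hac : a ≠ c) :
    ∑ i ∈ univ \ ({a, b, c} : Finset β), ∑ j ∈ univ \ {i}, Acl i j =
      (∑ r ∈ univ \ {a, b, c}, Acl a r) + (∑ r ∈ univ \ {a, b, c}, Acl b r) + (∑ r ∈ univ \ {a, b, c}, Acl c r) +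
        ∑ i ∈ univ \ ({a, b, c} : Finset β), ∑ j ∈ (univ \ ({a, b, c} : Finset β)) \ {i}, Acl i j := by
  have hrow : ∀ i ∈ univ \ ({a, b, c} : Finset β), ∑ j ∈ univ \ {i}, Acl i j =
      Acl i a + Acl i b + Acl i c + ∑ j ∈ (univ \ ({a, b, c} : Finset β)) \ {i}, Acl i j := by
    intro i hi
    have h1 : ∑ j, Acl i j = Acl i i + ∑ j ∈ univ \ {i}, Acl i j := by
      rw [← sum_sdiff (subset_univ ({i} : Finset β)), sum_singleton]; ring
    have h2 := sum_univ_split_three hab hbc hac (Acl i)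
    have h3 : ∑ j ∈ univ \ ({a, b, c} : Finset β), Acl i j =
        Acl i i + ∑ j ∈ (univ \ ({a, b, c} : Finset β)) \ {i}, Acl i j := by
      rw [← sum_sdiff (singleton_subset_iff.2 hi), sum_singleton]; ring
    linarith
  rw [sum_congr rfl hrow, sum_add_distrib, sum_add_distrib, sum_add_distrib,
    sum_remainder_symm Acl hs _ a, sum_remainder_symm Acl hs _ b, sum_remainder_symm Acl hs _ c]

/-- The off-diagonal pair sum of `classCross_sum`, restricted to its support. -/
theorem offdiag_sum_restrict (Acl : β → β → ℝ) (P : Finset β) :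
    (∑ i, ∑ j, (if (i ∈ P ∧ j ∈ P) ∧ i ≠ j then Acl i j / 2 else 0)) =
      (∑ i ∈ P, ∑ j ∈ P \ {i}, Acl i j) / 2 := by
  have hinner : ∀ i ∈ P, (∑ j, (if (i ∈ P ∧ j ∈ P) ∧ i ≠ j then Acl i j / 2 else 0)) =
      ∑ j ∈ P \ {i}, Acl i j / 2 := by
    intro i hi
    rw [← sum_subset (subset_univ (P \ {i}))]
    · refine sum_congr rfl fun j hj => ?_
      rw [mem_sdiff, mem_singleton] at hj
      rw [if_pos ⟨⟨hi, hj.1⟩, fun e => hj.2 e.symm⟩]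
    · intro j _ hj
      rw [if_neg]
      intro h
      exact hj (mem_sdiff.2 ⟨h.1.2, fun e => h.2 (mem_singleton.1 e).symm⟩)
  have houter : (∑ i, ∑ j, (if (i ∈ P ∧ j ∈ P) ∧ i ≠ j then Acl i j / 2 else 0)) =
      ∑ i ∈ P, ∑ j, (if (i ∈ P ∧ j ∈ P) ∧ i ≠ j then Acl i j / 2 else 0) := by
    rw [← sum_subset (subset_univ P)]
    intro i _ hi
    exact sum_eq_zero fun j _ => by rw [if_neg]; exact fun h => hi h.1.1
  rw [houter, sum_congr rfl hinner, sum_div]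
  exact sum_congr rfl fun i _ => by rw [sum_div]

/-- Symmetry of cuts: `Σ_{i∉P} Σ_{j∈P} Acl i j = Σ_{i∈P} Σ_{j∉P} Acl i j`. -/
theorem cut_symm (Acl : β → β → ℝ) (hs : ∀ i j, Acl i j = Acl j i) (P : Finset β) :
    ∑ i ∈ univ \ P, ∑ j ∈ P, Acl i j = ∑ i ∈ P, ∑ j ∈ univ \ P, Acl i j := by
  rw [sum_comm]
  exact sum_congr rfl fun i _ => sum_congr rfl fun j _ => hs j i

end Summit.Ventures.Crystal3D.Theorems
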